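/-
Copyright (c) 2026 the pub-hodgecm-mathlib formalisation cell (harness21).  Prover seat hodgecm-mathlib-K2E3-p25 (g5), Track B «K2-LIT»,
hLiu418 = `stmt-HodgeConjecture-24832`; K1a desk WORDS #36∕#38 «(C-K-1c)», FILE 1 of 3: the explicit ray derivative in FACTORED form.
THEOREMS ONLY (no `def`, no instance, no notation, no named-fact hypothesis, no `sorry`); lane `--supports stmt-HodgeConjecture-24832 --as helper`.
-/
import Summits.HodgeConjecture.HodgeConjecture.Theorems.K2LiuArchTwistedRayAtomBounds      -- ★ p865381 (C-K-1a): atom velocities with majorants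
import Summits.HodgeConjecture.HodgeConjecture.Theorems.K2LiuArchRayDerivLetters          -- ★ `hasDerivAt_zpow_comp`, `hasDerivAt_ofReal_cpow_const`, `hasDerivAt_comp_weightParam`
import HarnessLib

/-!
# Crux `HLiu418`, (Φ-S1) road B, (C-K-1c) FILE 1: THE RAY DERIVATIVE OF THE EXPLICIT SCALAR-TYPE LETTER IN FACTORED FORM
# `d/dτ|₀ Ac s (g·exp(τX)) = G₀ · (Φ_N(P,s)·Λ + P′·(−(β₀+s−1))·Φ_N(β₀+1; P, s))`

Cell `hodgecm-mathlib`, crux item hLiu418 = `stmt-HodgeConjecture-24832` (helper lane, count-neutral).  ★ FILE 2b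
(`exists_hasDerivAt_continuedFormula_ray`) differentiates ★ p864004's explicit letter along `g·exp(τX)` by the product rule with OPAQUE atom
velocities.  Here, with ★ (C-K-1a)'s explicit velocities, every factor except the witness `Φ_N` has a velocity in LOG FORM `fᵢ′ = fᵢ(0)·ℓᵢ`
(`ℓ₁ = −k·tr`, `ℓ₂ = (k−2s−2)·Re tr`, `ℓ₃ = 2πi·u′`, `ℓ₅ = −P′/P − P′πt`, `ℓ₆ = (2s)·(P′/P + 2 Re tr)` using §1 `1/q′ = P·‖det d‖²/4`), so the
derivative is `G₀·(Φ·Λ + Φ′)` with `G₀` = the letter without its witness factor, `Λ = Σ ℓᵢ`, `Φ′ = P′·(−(β₀+s−1))·Φ_N(α₀, β₀+1, P, s)`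
(★ ParamSmooth (d)); `P′, u′` carry ★ (C-K-1a)'s majorants `|P′| ≤ 256R²·RX·P`, `‖u′‖ ≤ 1056(1+R)⁴·RX·(tP)`.  FILE 2 bounds it, FILE 3 packages
the rung letters with growth.
* §1 `inv_qPrime_eq`; §2 **`hasDerivAt_continuedFormula_ray_explicit`**.

HONEST LABEL: calculus, closes no socket; HC_CM is proved only modulo the 7 printed citations (2 remaining named inputs: hLiu418 =
`stmt-HodgeConjecture-24832`, h413 = `stmt-HodgeConjecture-24833`) until rung 0 closes.  REL ≠ ★ ≠ BUILT.

## References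
* [Knapp1986] A. W. Knapp, *Representation Theory of Semisimple Groups*, Princeton (1986), Ch. VIII §3.
* [Shimura1982] G. Shimura, *Confluent hypergeometric functions on tube domains*, Math. Ann. 260 (1982), §3 Thm. 3.1, §4 Thm. 4.2.
* [Shimura1997] G. Shimura, *Euler Products and Eisenstein Series*, CBMS 93 (1997), §6.3, §16.4.
-/

set_option autoImplicit false
set_option linter.dupNamespace false

noncomputable section

open Complex Matrix NormedSpace Set
open scoped ComplexConjugate ComplexOrder

namespace Summit.HodgeConjecture.HodgeConjecture.Cruxes.HLiu418.K2LiuArchTwistedRayFactorDerivs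

open Literature.NumberTheory.ModularForms.SiegelUpperHalfSpace (num denom moeb)
open Summit.HodgeConjecture.HodgeConjecture.Cruxes.HLiu418.K2LiuHermTwoGammaDefs
open Summit.HodgeConjecture.HodgeConjecture.Cruxes.HLiu418.K2LiuHermitianTubeCocycle (mul_mem_UJ isUnit_det_denom posDef_im_moeb posDef_im_I_smul_one)
open Summit.HodgeConjecture.HodgeConjecture.Cruxes.HLiu418.K2LiuLieRayDifferentiability (conjTranspose_exp_mul_J_mul_exp)
open Summit.HodgeConjecture.HodgeConjecture.Cruxes.HLiu418.K2LiuArchSiegelHalfSpaceHeightBounds (im_moeb_I_eq)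
open Summit.HodgeConjecture.HodgeConjecture.Cruxes.HLiu418.K2LiuArchPointRayCalculus (differentiable_pointData_mul_exp)
open Summit.HodgeConjecture.HodgeConjecture.Cruxes.HLiu418.K2LiuArchRayDerivLetters (hasDerivAt_zpow_comp hasDerivAt_ofReal_cpow_const hasDerivAt_comp_weightParam)
open Summit.HodgeConjecture.HodgeConjecture.Cruxes.HLiu418.K2LiuArchTwistedRayAtomBounds

/-! ## §1 The `q′`-atom dissolves: `1/q′ = P·‖det d‖²/4` on `U(J)` -/

/-- **`1/(Q − |w|²/P) = P·‖det denom(h, i1)‖²/4`** for `h ∈ U(J)`, `‖det a‖ = 1` (`PQ − |w|² = det(aᴴ(2V)a) = 4·det V`, `det V = ‖det d‖⁻²` by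
★ `im_moeb_I_eq`). [Shimura1997, §6.3] -/
theorem inv_qPrime_eq {h : Matrix (Fin 2 ⊕ Fin 2) (Fin 2 ⊕ Fin 2) ℂ} (hh : hᴴ * Matrix.J (Fin 2) ℂ * h = Matrix.J (Fin 2) ℂ)
    {a : Matrix (Fin 2) (Fin 2) ℂ} (hdet : ‖a.det‖ = 1) :
    1 / ((((aᴴ * ((2 : ℂ) • ((2 * I)⁻¹ • (moeb h (I • (1 : Matrix (Fin 2) (Fin 2) ℂ)) - (moeb h (I • (1 : Matrix (Fin 2) (Fin 2) ℂ)))ᴴ))) * a) 1 1).re) - normSq ((aᴴ * ((2 : ℂ) • ((2 * I)⁻¹ • (moeb h (I • (1 : Matrix (Fin 2) (Fin 2) ℂ)) - (moeb h (I • (1 : Matrix (Fin 2) (Fin 2) ℂ)))ᴴ))) * a) 0 1) / (((aᴴ * ((2 : ℂ) • ((2 * I)⁻¹ • (moeb h (I • (1 : Matrix (Fin 2) (Fin 2) ℂ)) - (moeb h (I • (1 : Matrix (Fin 2) (Fin 2) ℂ)))ᴴ))) * a) 0 0).re)) = (((aᴴ * ((2 : ℂ) • ((2 * I)⁻¹ •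 (moeb h (I • (1 : Matrix (Fin 2) (Fin 2) ℂ)) - (moeb h (I • (1 : Matrix (Fin 2) (Fin 2) ℂ)))ᴴ))) * a) 0 0).re) * ‖(denom h (I • (1 : Matrix (Fin 2) (Fin 2) ℂ))).det‖ ^ 2 / 4 := by
  set V : Matrix (Fin 2) (Fin 2) ℂ := ((2 * I)⁻¹ • (moeb h (I • (1 : Matrix (Fin 2) (Fin 2) ℂ)) - (moeb h (I • (1 : Matrix (Fin 2) (Fin 2) ℂ)))ᴴ)) with hV
  set gm : Matrix (Fin 2) (Fin 2) ℂ := aᴴ * ((2 : ℂ) • V) * a with hgm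
  set P : ℝ := (gm 0 0).re with hP
  set Q : ℝ := (gm 1 1).re with hQ
  set w : ℂ := gm 0 1 with hw
  set δ : ℂ := (denom h (I • (1 : Matrix (Fin 2) (Fin 2) ℂ))).det with hδ
  have ha0 : a.det ≠ 0 := fun h0 => by rw [h0, norm_zero] at hdet; exact zero_ne_one hdet
  have haU : IsUnit a := (Matrix.isUnit_iff_isUnit_det a).mpr (Ne.isUnit ha0)
  have hVpos : V.PosDef := posDef_im_moeb hh posDef_im_I_smul_one
  have h2V : ((2 : ℂ) • V).PosDef := by
    have h2 := hVpos.smul (by norm_num : (0 : ℝ) < 2)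
    rwa [show ((2 : ℝ) • V) = ((2 : ℂ) • V) by rw [← Complex.coe_smul]; norm_num] at h2
  have hg' : gm.PosDef := by
    have := Matrix.IsUnit.posDef_star_left_conjugate_iff (x := (2 : ℂ) • V) haU
    rw [Matrix.star_eq_conjTranspose] at this
    exact this.mpr h2V
  have he : hermTwo (P, w, Q) = gm := hermTwo_eq_of_isHermitian hg'.1
  have hg'' : (hermTwo (P, w, Q)).PosDef := by rw [he]; exact hg'
  obtain ⟨hp, hpq⟩ := (posDef_hermTwo_iff _).mp hg''
  simp only at hp hpq
  have hdetg : gm.det = ((P * Q - normSq w : ℝ) : ℂ) := by rw [← he, det_hermTwo]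
  have hnormg : ‖gm.det‖ = 4 * ‖V.det‖ := by
    rw [hgm, det_mul, det_mul, det_conjTranspose, det_smul, Fintype.card_fin]
    simp only [norm_mul, norm_pow, Complex.star_def, Complex.norm_conj, hdet, Complex.norm_ofNat]
    norm_num
  have hPQ : P * Q - normSq w = 4 * ‖V.det‖ := by
    rw [← hnormg, hdetg, Complex.norm_real, Real.norm_of_nonneg (sub_nonneg.2 hpq.le)]
  have hVdet : ‖V.det‖ = (‖δ‖ ^ 2)⁻¹ := by
    rw [hV, im_moeb_I_eq hh, det_mul, Matrix.det_nonsing_inv, Matrix.det_nonsing_inv, Ring.inverse_eq_inv', det_conjTranspose, norm_mul,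
      norm_inv, norm_inv, norm_star, ← mul_inv, ← sq, ← hδ]
  have hQ' : Q - normSq w / P = (P * Q - normSq w) / P := by rw [sub_div, mul_div_cancel_left₀ Q hp.ne']
  rw [hQ', one_div_div, hPQ, hVdet]
  field_simp

/-! ## §1b Scalar bookkeeping: each factor's velocity in log form -/

/-- `(−k)·δ^{−k−1}·(δ·tr) = δ^{−k}·(−k·tr)` (`δ ≠ 0`). [folklore] -/
theorem alg_zpow (δ tr : ℂ) (k : ℤ) (hδ : δ ≠ 0) : ((-k : ℤ) : ℂ) * δ ^ (-k - 1) * (δ * tr) = δ ^ (-k) * (-(k : ℂ) * tr) := by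
  rw [zpow_sub_one₀ hδ, Int.cast_neg]
  field_simp

/-- `c·ρ^{c−1}·(ρ·r) = ρ^c·(c·r)` for a real base `ρ > 0`. [folklore] -/
theorem alg_cpow (ρ r : ℝ) (c : ℂ) (hρ : 0 < ρ) : c * ((ρ : ℝ) : ℂ) ^ (c - 1) * (((ρ * r : ℝ)) : ℂ) = ((ρ : ℝ) : ℂ) ^ c * (c * ((r : ℝ) : ℂ)) := by
  have hx0 : ((ρ : ℝ) : ℂ) ≠ 0 := by exact_mod_cast hρ.ne'
  rw [Complex.cpow_sub _ _ hx0, Complex.cpow_one, Complex.ofReal_mul]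
  field_simp

/-- The velocity of `(π/P)·e^{−P·πt}` in log form: `… = (π/P)e^{−Pπt}·(−P′/P − P′πt)`. [folklore] -/
theorem alg_R1 (P P' t : ℝ) (hP : 0 < P) :
    (0 * ((P : ℝ) : ℂ) - (Real.pi : ℂ) * ((P' : ℝ) : ℂ)) / ((P : ℝ) : ℂ) ^ 2 * cexp (-(((P * (Real.pi * t) : ℝ)) : ℂ)) +
      (Real.pi : ℂ) / ((P : ℝ) : ℂ) * (cexp (-(((P * (Real.pi * t) : ℝ)) : ℂ)) * -(((P' * (Real.pi * t) : ℝ)) : ℂ)) =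
    ((Real.pi : ℂ) / ((P : ℝ) : ℂ) * cexp (-(((P * (Real.pi * t) : ℝ)) : ℂ))) * (-(((P' : ℝ) : ℂ) / ((P : ℝ) : ℂ)) - (((P' * (Real.pi * t) : ℝ)) : ℂ)) := by
  have hx0 : ((P : ℝ) : ℂ) ≠ 0 := by exact_mod_cast hP.ne'
  field_simp
  ring

/-- The velocity of `x = P·ρ²/4` in log form: `(P′ρ² + P·2ρ·(ρ·r))/4 = x·(P′/P + 2r)`. [folklore] -/
theorem alg_x0 (x P P' ρ r : ℝ) (hP : 0 < P) (hxe : x = P * ρ ^ 2 / 4) :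
    (P' * ρ ^ 2 + P * ((2 : ℕ) * ρ ^ (2 - 1) * (ρ * r))) / 4 = x * (P' / P + 2 * r) := by
  rw [hxe]; field_simp; ring

/-- `e·x^{e−1}·(x·L) = x^e·(e·L)` for a real base `x > 0`. [folklore] -/
theorem alg_cpow' (x L : ℝ) (e : ℂ) (hx : 0 < x) : e * ((x : ℝ) : ℂ) ^ (e - 1) * (((x * L : ℝ)) : ℂ) = ((x : ℝ) : ℂ) ^ e * (e * ((L : ℝ) : ℂ)) := by
  have hx0 : ((x : ℝ) : ℂ) ≠ 0 := by exact_mod_cast hx.ne'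
  rw [Complex.cpow_sub _ _ hx0, Complex.cpow_one, Complex.ofReal_mul]
  field_simp

/-! ## §2 The ray derivative of the explicit letter, factored -/

/-- **THE RAY DERIVATIVE OF THE EXPLICIT SCALAR-TYPE LETTER, FACTORED** (`g ∈ U(J)` entries `≤ R`, `X ∈ 𝔲(J)` entries `≤ RX`, `‖det a‖ = 1`,
`t > 0`, `k∕2 < N`, `Φ` with ★ ParamSmooth (d)): there are `P′ : ℝ`, `u′ : ℂ` with ★ (C-K-1a)'s majorants `|P′| ≤ 256·R²·RX·P(g)`,
`‖u′‖ ≤ 1056·(1+R)⁴·RX·(t·P(g))` such that for every `s` with `0 < re s`,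
`HasDerivAt (τ ↦ Ac s (g·exp(τX))) (G₀·(Φ_N(P,s)·Λ + Φ′)) 0` with `G₀, Λ, Φ′` as in the module doc (all factors read off at `g`).
[Knapp1986, Ch. VIII §3] [Shimura1982, §4 Thm. 4.2] [Shimura1997, §16.4] -/
theorem hasDerivAt_continuedFormula_ray_explicit (k : ℤ) {g X : Matrix (Fin 2 ⊕ Fin 2) (Fin 2 ⊕ Fin 2) ℂ}
    (hg : gᴴ * Matrix.J (Fin 2) ℂ * g = Matrix.J (Fin 2) ℂ) (hX : Xᴴ * Matrix.J (Fin 2) ℂ + Matrix.J (Fin 2) ℂ * X = 0)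
    {R RX : ℝ} (hR : ∀ i j, ‖g i j‖ ≤ R) (hRX : ∀ i j, ‖X i j‖ ≤ RX) {a : Matrix (Fin 2) (Fin 2) ℂ} (hdet : ‖a.det‖ = 1) {t : ℝ} (ht : 0 < t)
    {N : ℕ} (hN : (k : ℝ) / 2 < N) (Φ : ℂ → ℂ → ℝ → ℂ → ℂ)
    (hΦd : ∀ (α₀ β₀ : ℂ) (p : ℝ), 0 < p → ∀ s : ℂ, 1 - (N : ℝ) < (β₀ + s).re →
      HasDerivAt (fun p' : ℝ => Φ α₀ β₀ p' s) (-(β₀ + s - 1) * Φ α₀ (β₀ + 1) p s) p) :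
    ∃ (P' : ℝ) (u' : ℂ), |P'| ≤ 256 * R ^ 2 * RX * (((aᴴ * ((2 : ℂ) • ((2 * I)⁻¹ • (moeb g (I • (1 : Matrix (Fin 2) (Fin 2) ℂ)) - (moeb g (I • (1 : Matrix (Fin 2) (Fin 2) ℂ)))ᴴ))) * a) 0 0).re) ∧ ‖u'‖ ≤ 1056 * (1 + R) ^ 4 * RX * (t * (((aᴴ * ((2 : ℂ) • ((2 * I)⁻¹ • (moeb g (I • (1 : Matrix (Fin 2) (Fin 2) ℂ)) - (moeb g (I • (1 : Matrix (Fin 2) (Fin 2) ℂ)))ᴴ))) * a) 0 0).re)) ∧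
      ∀ s : ℂ, 0 < s.re → HasDerivAt (fun τ : ℝ =>
        ((denom (g * NormedSpace.exp (τ • X)) (I • (1 : Matrix (Fin 2) (Fin 2) ℂ))).det ^ (-k) *
            (((‖(denom (g * NormedSpace.exp (τ • X)) (I • (1 : Matrix (Fin 2) (Fin 2) ℂ))).det‖ : ℝ)) : ℂ) ^ ((k : ℂ) - 2 * s - 2) *
            cexp ((2 * Real.pi * I) * (((a * hermTwo (t, 0, 0) * aᴴ) * ((2 : ℂ)⁻¹ • (moeb (g * NormedSpace.exp (τ • X)) (I • (1 : Matrix (Fin 2) (Fin 2) ℂ)) + (moeb (g * NormedSpace.exp (τ • X)) (I • (1 : Matrix (Fin 2) (Fin 2) ℂ)))ᴴ))).trace))) *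
          ((1 / 8 : ℂ) * (((((4 * Real.pi ^ 4 : ℝ)) : ℂ) * cexp ((Real.pi * I) * ((s + 1 - k / 2) - (s + 1 + k / 2))) * ((Real.pi : ℂ)⁻¹ * (Complex.Gamma (s + 1 + k / 2))⁻¹ * (Complex.Gamma (s + 1 + k / 2 - 1))⁻¹) * ((Real.pi : ℂ)⁻¹ * (Complex.Gamma (s + 1 - k / 2))⁻¹)) *
            (((Real.pi : ℂ) / (((aᴴ * ((2 : ℂ) • ((2 * I)⁻¹ • (moeb (g * NormedSpace.exp (τ • X)) (I • (1 : Matrix (Fin 2) (Fin 2) ℂ)) - (moeb (g * NormedSpace.exp (τ • X)) (I • (1 : Matrix (Fin 2) (Fin 2) ℂ)))ᴴ))) * a) 0 0).re) * cexp (-(((((aᴴ * ((2 : ℂ) • ((2 * I)⁻¹ • (moeb (g * NormedSpace.exp (τ • X)) (I • (1 : Matrix (Fin 2) (Fin 2) ℂ)) - (moeb (g * NormedSpace.exp (τ • X)) (I • (1 : Matrix (Fin 2) (Fin 2) ℂ)))ᴴ))) * a) 0 0).re) * (Real.pi * t) : ℝ) : ℂ))) *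
              ((1 / (((((aᴴ * ((2 : ℂ) • ((2 * I)⁻¹ • (moeb (g * NormedSpace.exp (τ • X)) (I • (1 : Matrix (Fin 2) (Fin 2) ℂ)) - (moeb (g * NormedSpace.exp (τ • X)) (I • (1 : Matrix (Fin 2) (Fin 2) ℂ)))ᴴ))) * a) 1 1).re) - normSq ((aᴴ * ((2 : ℂ) • ((2 * I)⁻¹ • (moeb (g * NormedSpace.exp (τ • X)) (I • (1 : Matrix (Fin 2) (Fin 2) ℂ)) - (moeb (g * NormedSpace.exp (τ • X)) (I • (1 : Matrix (Fin 2) (Fin 2) ℂ)))ᴴ))) * a) 0 1) / (((aᴴ * ((2 : ℂ) • ((2 * I)⁻¹ • (moeb (g * NormedSpace.exp (τ • X)) (I • (1 : Matrix (Fin 2) (Fin 2) ℂ)) - (moeb (g * NormedSpace.exp (τ • X)) (I • (1 : Matrix (Fin 2) (Fin 2) ℂ)))ᴴ))) * a) 0 0).re) : ℝ) : ℂ)) ^ ((s + 1 + k / 2) + (s + 1 - k / 2) - 2) * Complex.Gamma (2 * s))) *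
            Φ (1 + k / 2) (1 - k / 2) (((aᴴ * ((2 : ℂ) • ((2 * I)⁻¹ • (moeb (g * NormedSpace.exp (τ • X)) (I • (1 : Matrix (Fin 2) (Fin 2) ℂ)) - (moeb (g * NormedSpace.exp (τ • X)) (I • (1 : Matrix (Fin 2) (Fin 2) ℂ)))ᴴ))) * a) 0 0).re) s)))
        ((((denom g (I • (1 : Matrix (Fin 2) (Fin 2) ℂ))).det ^ (-k) * (((‖(denom g (I • (1 : Matrix (Fin 2) (Fin 2) ℂ))).det‖ : ℝ)) : ℂ) ^ ((k : ℂ) - 2 * s - 2) * cexp ((2 * Real.pi * I) * (((a * hermTwo (t, 0, 0) * aᴴ) * ((2 : ℂ)⁻¹ • (moeb g (I • (1 : Matrix (Fin 2) (Fin 2) ℂ)) + (moeb g (I • (1 : Matrix (Fin 2) (Fin 2) ℂ)))ᴴ))).trace))) * ((1 / 8 : ℂ) * (((((4 * Real.pi ^ 4 : ℝ)) : ℂ) * cexp ((Real.pi * I) * ((s + 1 - k / 2) - (s + 1 + k / 2))) * ((Real.pi : ℂ)⁻¹ * (Complex.Gamma (s + 1 + k / 2))⁻¹ * (Complex.Gamma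 (s + 1 + k / 2 - 1))⁻¹) * ((Real.pi : ℂ)⁻¹ * (Complex.Gamma (s + 1 - k / 2))⁻¹)) * (((Real.pi : ℂ) / (((aᴴ * ((2 : ℂ) • ((2 * I)⁻¹ • (moeb g (I • (1 : Matrix (Fin 2) (Fin 2) ℂ)) - (moeb g (I • (1 : Matrix (Fin 2) (Fin 2) ℂ)))ᴴ))) * a) 0 0).re) * cexp (-(((((aᴴ * ((2 : ℂ) • ((2 * I)⁻¹ • (moeb g (I • (1 : Matrix (Fin 2) (Fin 2) ℂ)) - (moeb g (I • (1 : Matrix (Fin 2) (Fin 2) ℂ)))ᴴ))) * a) 0 0).re) * (Real.pi * t) : ℝ) : ℂ))) * ((1 / (((((aᴴ * ((2 : ℂ) • ((2 * I)⁻¹ • (moeb g (I • (1 : Matrix (Fin 2) (Fin 2) ℂ)) - (moeb g (I • (1 : Matrix (Fin 2) (Fin 2) ℂ)))ᴴ))) * a) 1 1).re) - normSq ((aᴴ * ((2 : ℂ) • ((2 * I)⁻¹ • (moeb g (I • (1 : Matrix (Fin 2) (Fin 2) ℂ)) - (moeb g (I • (1 : Matrix (Fin 2) (Fin 2) ℂ)))ᴴ)))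 * a) 0 1) / (((aᴴ * ((2 : ℂ) • ((2 * I)⁻¹ • (moeb g (I • (1 : Matrix (Fin 2) (Fin 2) ℂ)) - (moeb g (I • (1 : Matrix (Fin 2) (Fin 2) ℂ)))ᴴ))) * a) 0 0).re) : ℝ) : ℂ)) ^ ((s + 1 + k / 2) + (s + 1 - k / 2) - 2) * Complex.Gamma (2 * s)))))) *
          (Φ (1 + k / 2) (1 - k / 2) (((aᴴ * ((2 : ℂ) • ((2 * I)⁻¹ • (moeb g (I • (1 : Matrix (Fin 2) (Fin 2) ℂ)) - (moeb g (I • (1 : Matrix (Fin 2) (Fin 2) ℂ)))ᴴ))) * a) 0 0).re) s * ((-(k : ℂ) * (((denom g (I • (1 : Matrix (Fin 2) (Fin 2) ℂ)))⁻¹ * denom (g * X) (I • (1 : Matrix (Fin 2) (Fin 2) ℂ))).trace)) + (((k : ℂ) - 2 * s - 2) * ((((((denom g (I • (1 : Matrix (Fin 2) (Fin 2) ℂ)))⁻¹ * denom (g * X) (I • (1 : Matrix (Fin 2) (Fin 2) ℂ))).trace)).re : ℝ) : ℂ)) + ((2 * Real.pi * I) * u') + (-(((P' : ℝ) : ℂ)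 / (((((aᴴ * ((2 : ℂ) • ((2 * I)⁻¹ • (moeb g (I • (1 : Matrix (Fin 2) (Fin 2) ℂ)) - (moeb g (I • (1 : Matrix (Fin 2) (Fin 2) ℂ)))ᴴ))) * a) 0 0).re) : ℝ) : ℂ)) - (((P' * (Real.pi * t) : ℝ)) : ℂ)) + (((s + 1 + k / 2) + (s + 1 - k / 2) - 2) * (((P' / (((aᴴ * ((2 : ℂ) • ((2 * I)⁻¹ • (moeb g (I • (1 : Matrix (Fin 2) (Fin 2) ℂ)) - (moeb g (I • (1 : Matrix (Fin 2) (Fin 2) ℂ)))ᴴ))) * a) 0 0).re) + 2 * ((((denom g (I • (1 : Matrix (Fin 2) (Fin 2) ℂ)))⁻¹ * denom (g * X) (I • (1 : Matrix (Fin 2) (Fin 2) ℂ))).trace)).re : ℝ)) : ℂ))) +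
            (((P' : ℝ) : ℂ) * (-((1 - (k : ℂ) / 2) + s - 1) * Φ (1 + k / 2) (1 - k / 2 + 1) (((aᴴ * ((2 : ℂ) • ((2 * I)⁻¹ • (moeb g (I • (1 : Matrix (Fin 2) (Fin 2) ℂ)) - (moeb g (I • (1 : Matrix (Fin 2) (Fin 2) ℂ)))ᴴ))) * a) 0 0).re) s)))) 0 := by
  have ha0 : a.det ≠ 0 := fun h0 => by rw [h0, norm_zero] at hdet; exact zero_ne_one hdet
  have haU : IsUnit a := (Matrix.isUnit_iff_isUnit_det a).mpr (Ne.isUnit ha0)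
  obtain ⟨-, -, -, -, hppos, -, hqpos⟩ := differentiable_pointData_mul_exp hg hX haU
  obtain ⟨P', hpd, hP'⟩ := exists_hasDerivAt_weightP_ray hg hX hR hRX a
  obtain ⟨u', hud, hu'⟩ := exists_hasDerivAt_traceU_ray hg hX hR hRX a ht.le
  refine ⟨P', u', hP', hu', fun s hs => ?_⟩
  have e0 : g * NormedSpace.exp ((0 : ℝ) • X) = g := by rw [zero_smul, NormedSpace.exp_zero, Matrix.mul_one]
  have hδ0 : (denom g (I • (1 : Matrix (Fin 2) (Fin 2) ℂ))).det ≠ 0 := (isUnit_det_denom hg posDef_im_I_smul_one).ne_zero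
  have hρ0 : 0 < ‖(denom g (I • (1 : Matrix (Fin 2) (Fin 2) ℂ))).det‖ := norm_pos_iff.mpr hδ0
  have hp0 : 0 < (((aᴴ * ((2 : ℂ) • ((2 * I)⁻¹ • (moeb g (I • (1 : Matrix (Fin 2) (Fin 2) ℂ)) - (moeb g (I • (1 : Matrix (Fin 2) (Fin 2) ℂ)))ᴴ))) * a) 0 0).re) := by have h := hppos 0; rwa [e0] at h
  have hpc : ((((((aᴴ * ((2 : ℂ) • ((2 * I)⁻¹ • (moeb g (I • (1 : Matrix (Fin 2) (Fin 2) ℂ)) - (moeb g (I • (1 : Matrix (Fin 2) (Fin 2) ℂ)))ᴴ))) * a) 0 0).re) : ℝ)) : ℂ) ≠ 0 := by exact_mod_cast hp0.ne'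
  -- (1) `δ^{−k}`
  have hX1 : HasDerivAt (fun τ : ℝ => (denom (g * NormedSpace.exp (τ • X)) (I • (1 : Matrix (Fin 2) (Fin 2) ℂ))).det ^ (-k)) ((denom g (I • (1 : Matrix (Fin 2) (Fin 2) ℂ))).det ^ (-k) * (-(k : ℂ) * (((denom g (I • (1 : Matrix (Fin 2) (Fin 2) ℂ)))⁻¹ * denom (g * X) (I • (1 : Matrix (Fin 2) (Fin 2) ℂ))).trace))) 0 := by
    refine (hasDerivAt_zpow_comp (hasDerivAt_det_denom_ray hg X) (by simpa only [e0] using hδ0) (-k)).congr_deriv ?_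
    simp only [e0]
    exact alg_zpow _ _ k hδ0
  -- (2) `‖δ‖^{k−2s−2}`
  have hX2 : HasDerivAt (fun τ : ℝ => (((‖(denom (g * NormedSpace.exp (τ • X)) (I • (1 : Matrix (Fin 2) (Fin 2) ℂ))).det‖ : ℝ)) : ℂ) ^ ((k : ℂ) - 2 * s - 2)) ((((‖(denom g (I • (1 : Matrix (Fin 2) (Fin 2) ℂ))).det‖ : ℝ)) : ℂ) ^ ((k : ℂ) - 2 * s - 2) * (((k : ℂ) - 2 * s - 2) * ((((((denom g (I • (1 : Matrix (Fin 2) (Fin 2) ℂ)))⁻¹ * denom (g * X) (I • (1 : Matrix (Fin 2) (Fin 2) ℂ))).trace)).re : ℝ) : ℂ))) 0 := by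
    refine (hasDerivAt_ofReal_cpow_const (hasDerivAt_norm_det_denom_ray hg X) (by simpa only [e0] using hρ0) _).congr_deriv ?_
    simp only [e0]
    exact alg_cpow _ _ _ hρ0
  -- (3) the character
  have hX3 : HasDerivAt (fun τ : ℝ => cexp ((2 * Real.pi * I) * (((a * hermTwo (t, 0, 0) * aᴴ) * ((2 : ℂ)⁻¹ • (moeb (g * NormedSpace.exp (τ • X)) (I • (1 : Matrix (Fin 2) (Fin 2) ℂ)) + (moeb (g * NormedSpace.exp (τ • X)) (I • (1 : Matrix (Fin 2) (Fin 2) ℂ)))ᴴ))).trace))) (cexp ((2 * Real.pi * I) * (((a * hermTwo (t, 0, 0) * aᴴ) * ((2 : ℂ)⁻¹ • (moeb g (I • (1 : Matrix (Fin 2) (Fin 2) ℂ)) + (moeb g (I • (1 : Matrix (Fin 2) (Fin 2) ℂ)))ᴴ))).trace)) * ((2 * Real.pi * I) * u')) 0 := by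
    have h := (hud.const_mul (2 * Real.pi * I)).cexp
    simp only [e0] at h
    exact h
  -- (5) `(π/P)·e^{−Pπt}`
  have hR1 : HasDerivAt (fun τ : ℝ => ((Real.pi : ℂ) / (((aᴴ * ((2 : ℂ) • ((2 * I)⁻¹ • (moeb (g * NormedSpace.exp (τ • X)) (I • (1 : Matrix (Fin 2) (Fin 2) ℂ)) - (moeb (g * NormedSpace.exp (τ • X)) (I • (1 : Matrix (Fin 2) (Fin 2) ℂ)))ᴴ))) * a) 0 0).re) * cexp (-(((((aᴴ * ((2 : ℂ) • ((2 * I)⁻¹ • (moeb (g * NormedSpace.exp (τ • X)) (I • (1 : Matrix (Fin 2) (Fin 2) ℂ)) - (moeb (g * NormedSpace.exp (τ • X)) (I • (1 : Matrix (Fin 2) (Fin 2) ℂ)))ᴴ))) * a) 0 0).re) * (Real.pi * t) : ℝ) : ℂ)))) (((Real.pi : ℂ) / (((aᴴ * ((2 : ℂ) • ((2 * I)⁻¹ • (moeb g (I • (1 : Matrix (Fin 2) (Fin 2) ℂ)) - (moeb g (I • (1 : Matrix (Fin 2) (Fin 2) ℂ)))ᴴ))) * a) 0 0).re) * cexp (-(((((aᴴ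 * ((2 : ℂ) • ((2 * I)⁻¹ • (moeb g (I • (1 : Matrix (Fin 2) (Fin 2) ℂ)) - (moeb g (I • (1 : Matrix (Fin 2) (Fin 2) ℂ)))ᴴ))) * a) 0 0).re) * (Real.pi * t) : ℝ) : ℂ))) * (-(((P' : ℝ) : ℂ) / (((((aᴴ * ((2 : ℂ) • ((2 * I)⁻¹ • (moeb g (I • (1 : Matrix (Fin 2) (Fin 2) ℂ)) - (moeb g (I • (1 : Matrix (Fin 2) (Fin 2) ℂ)))ᴴ))) * a) 0 0).re) : ℝ) : ℂ)) - (((P' * (Real.pi * t) : ℝ)) : ℂ))) 0 := by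
    have h1 := (hasDerivAt_const (0 : ℝ) (Real.pi : ℂ)).fun_div hpd.ofReal_comp (by simpa only [e0] using hpc)
    have h2 := ((hpd.mul_const (Real.pi * t)).ofReal_comp.fun_neg).cexp
    refine (h1.fun_mul h2).congr_deriv ?_
    simp only [e0]
    exact alg_R1 _ P' t hp0
  -- (6) `(1/q′)^{2s}` through `1/q′ = P‖δ‖²/4`
  have hxfun : (fun τ : ℝ => 1 / ((((aᴴ * ((2 : ℂ) • ((2 * I)⁻¹ • (moeb (g * NormedSpace.exp (τ • X)) (I • (1 : Matrix (Fin 2) (Fin 2) ℂ)) - (moeb (g * NormedSpace.exp (τ • X)) (I • (1 : Matrix (Fin 2) (Fin 2) ℂ)))ᴴ))) * a) 1 1).re) - normSq ((aᴴ * ((2 : ℂ) • ((2 * I)⁻¹ • (moeb (g * NormedSpace.exp (τ • X)) (I • (1 : Matrix (Fin 2) (Fin 2) ℂ)) - (moeb (g * NormedSpace.exp (τ • X)) (I • (1 : Matrix (Fin 2) (Fin 2) ℂ)))ᴴ))) * a) 0 1) / (((aᴴ * ((2 : ℂ) • ((2 * I)⁻¹ • (moeb (g * NormedSpace.exp (τ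 • X)) (I • (1 : Matrix (Fin 2) (Fin 2) ℂ)) - (moeb (g * NormedSpace.exp (τ • X)) (I • (1 : Matrix (Fin 2) (Fin 2) ℂ)))ᴴ))) * a) 0 0).re))) = fun τ : ℝ => (((aᴴ * ((2 : ℂ) • ((2 * I)⁻¹ • (moeb (g * NormedSpace.exp (τ • X)) (I • (1 : Matrix (Fin 2) (Fin 2) ℂ)) - (moeb (g * NormedSpace.exp (τ • X)) (I • (1 : Matrix (Fin 2) (Fin 2) ℂ)))ᴴ))) * a) 0 0).re) * ‖(denom (g * NormedSpace.exp (τ • X)) (I • (1 : Matrix (Fin 2) (Fin 2) ℂ))).det‖ ^ 2 / 4 :=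
    funext fun τ => inv_qPrime_eq (mul_mem_UJ hg (conjTranspose_exp_mul_J_mul_exp hX τ)) hdet
  have hx0 : 0 < 1 / ((((aᴴ * ((2 : ℂ) • ((2 * I)⁻¹ • (moeb g (I • (1 : Matrix (Fin 2) (Fin 2) ℂ)) - (moeb g (I • (1 : Matrix (Fin 2) (Fin 2) ℂ)))ᴴ))) * a) 1 1).re) - normSq ((aᴴ * ((2 : ℂ) • ((2 * I)⁻¹ • (moeb g (I • (1 : Matrix (Fin 2) (Fin 2) ℂ)) - (moeb g (I • (1 : Matrix (Fin 2) (Fin 2) ℂ)))ᴴ))) * a) 0 1) / (((aᴴ * ((2 : ℂ) • ((2 * I)⁻¹ • (moeb g (I • (1 : Matrix (Fin 2) (Fin 2) ℂ)) - (moeb g (I • (1 : Matrix (Fin 2) (Fin 2) ℂ)))ᴴ))) * a) 0 0).re)) := by have h := hqpos 0; rw [e0] at h; exact one_div_pos.2 h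
  have hxq : HasDerivAt (fun τ : ℝ => 1 / ((((aᴴ * ((2 : ℂ) • ((2 * I)⁻¹ • (moeb (g * NormedSpace.exp (τ • X)) (I • (1 : Matrix (Fin 2) (Fin 2) ℂ)) - (moeb (g * NormedSpace.exp (τ • X)) (I • (1 : Matrix (Fin 2) (Fin 2) ℂ)))ᴴ))) * a) 1 1).re) - normSq ((aᴴ * ((2 : ℂ) • ((2 * I)⁻¹ • (moeb (g * NormedSpace.exp (τ • X)) (I • (1 : Matrix (Fin 2) (Fin 2) ℂ)) - (moeb (g * NormedSpace.exp (τ • X)) (I • (1 : Matrix (Fin 2) (Fin 2) ℂ)))ᴴ))) * a) 0 1) / (((aᴴ * ((2 : ℂ) • ((2 * I)⁻¹ • (moeb (g * NormedSpace.exp (τ • X)) (I • (1 : Matrix (Fin 2) (Fin 2) ℂ)) - (moeb (g * NormedSpace.exp (τ • X)) (I • (1 : Matrix (Fin 2) (Fin 2) ℂ)))ᴴ))) * a) 0 0).re))) ((1 / ((((aᴴ * ((2 : ℂ) • ((2 * I)⁻¹ • (moeb g (I • (1 : Matrix (Fin 2) (Fin 2) ℂ)) - (moeb g (I • (1 : Matrix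 (Fin 2) (Fin 2) ℂ)))ᴴ))) * a) 1 1).re) - normSq ((aᴴ * ((2 : ℂ) • ((2 * I)⁻¹ • (moeb g (I • (1 : Matrix (Fin 2) (Fin 2) ℂ)) - (moeb g (I • (1 : Matrix (Fin 2) (Fin 2) ℂ)))ᴴ))) * a) 0 1) / (((aᴴ * ((2 : ℂ) • ((2 * I)⁻¹ • (moeb g (I • (1 : Matrix (Fin 2) (Fin 2) ℂ)) - (moeb g (I • (1 : Matrix (Fin 2) (Fin 2) ℂ)))ᴴ))) * a) 0 0).re))) * (P' / (((aᴴ * ((2 : ℂ) • ((2 * I)⁻¹ • (moeb g (I • (1 : Matrix (Fin 2) (Fin 2) ℂ)) - (moeb g (I • (1 : Matrix (Fin 2) (Fin 2) ℂ)))ᴴ))) * a) 0 0).re) + 2 * ((((denom g (I • (1 : Matrix (Fin 2) (Fin 2) ℂ)))⁻¹ * denom (g * X) (I • (1 : Matrix (Fin 2) (Fin 2) ℂ))).trace)).re)) 0 := by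
    rw [hxfun]
    refine ((hpd.fun_mul ((hasDerivAt_norm_det_denom_ray hg X).fun_pow 2)).div_const 4).congr_deriv ?_
    simp only [e0]
    exact alg_x0 _ _ P' _ _ hp0 (inv_qPrime_eq hg hdet)
  have hX6 : HasDerivAt (fun τ : ℝ => (1 / (((((aᴴ * ((2 : ℂ) • ((2 * I)⁻¹ • (moeb (g * NormedSpace.exp (τ • X)) (I • (1 : Matrix (Fin 2) (Fin 2) ℂ)) - (moeb (g * NormedSpace.exp (τ • X)) (I • (1 : Matrix (Fin 2) (Fin 2) ℂ)))ᴴ))) * a) 1 1).re) - normSq ((aᴴ * ((2 : ℂ) • ((2 * I)⁻¹ • (moeb (g * NormedSpace.exp (τ • X)) (I • (1 : Matrix (Fin 2) (Fin 2) ℂ)) - (moeb (g * NormedSpace.exp (τ • X)) (I • (1 : Matrix (Fin 2) (Fin 2) ℂ)))ᴴ))) * a) 0 1) / (((aᴴ * ((2 : ℂ) • ((2 * I)⁻¹ • (moeb (g * NormedSpace.exp (τ • X)) (I • (1 : Matrix (Fin 2) (Fin 2) ℂ)) - (moeb (g * NormedSpace.exp (τ • X)) (I • (1 : Matrix (Fin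 2) (Fin 2) ℂ)))ᴴ))) * a) 0 0).re) : ℝ) : ℂ)) ^ ((s + 1 + k / 2) + (s + 1 - k / 2) - 2)) ((1 / (((((aᴴ * ((2 : ℂ) • ((2 * I)⁻¹ • (moeb g (I • (1 : Matrix (Fin 2) (Fin 2) ℂ)) - (moeb g (I • (1 : Matrix (Fin 2) (Fin 2) ℂ)))ᴴ))) * a) 1 1).re) - normSq ((aᴴ * ((2 : ℂ) • ((2 * I)⁻¹ • (moeb g (I • (1 : Matrix (Fin 2) (Fin 2) ℂ)) - (moeb g (I • (1 : Matrix (Fin 2) (Fin 2) ℂ)))ᴴ))) * a) 0 1) / (((aᴴ * ((2 : ℂ) • ((2 * I)⁻¹ • (moeb g (I • (1 : Matrix (Fin 2) (Fin 2) ℂ)) - (moeb g (I • (1 : Matrix (Fin 2) (Fin 2) ℂ)))ᴴ))) * a) 0 0).re) : ℝ) : ℂ)) ^ ((s + 1 + k / 2) + (s + 1 - k / 2) - 2) * (((s + 1 + k / 2) + (s + 1 - k / 2) - 2) * (((P' / (((aᴴ * ((2 : ℂ) • ((2 * I)⁻¹ • (moeb g (I • (1 : Matrix (Fin 2) (Fin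 2) ℂ)) - (moeb g (I • (1 : Matrix (Fin 2) (Fin 2) ℂ)))ᴴ))) * a) 0 0).re) + 2 * ((((denom g (I • (1 : Matrix (Fin 2) (Fin 2) ℂ)))⁻¹ * denom (g * X) (I • (1 : Matrix (Fin 2) (Fin 2) ℂ))).trace)).re : ℝ)) : ℂ))) 0 := by
    have h := hasDerivAt_ofReal_cpow_const hxq (by simpa only [e0] using hx0) ((s + 1 + k / 2) + (s + 1 - k / 2) - 2)
    simp only [e0] at h
    refine (h.congr_of_eventuallyEq (Filter.Eventually.of_forall fun τ => ?_)).congr_deriv ?_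
    · simp only [one_div, Complex.ofReal_inv]
    · rw [show ((1 : ℂ) / (((((((aᴴ * ((2 : ℂ) • ((2 * I)⁻¹ • (moeb g (I • (1 : Matrix (Fin 2) (Fin 2) ℂ)) - (moeb g (I • (1 : Matrix (Fin 2) (Fin 2) ℂ)))ᴴ))) * a) 1 1).re) - normSq ((aᴴ * ((2 : ℂ) • ((2 * I)⁻¹ • (moeb g (I • (1 : Matrix (Fin 2) (Fin 2) ℂ)) - (moeb g (I • (1 : Matrix (Fin 2) (Fin 2) ℂ)))ᴴ))) * a) 0 1) / (((aᴴ * ((2 : ℂ) • ((2 * I)⁻¹ • (moeb g (I • (1 : Matrix (Fin 2) (Fin 2) ℂ)) - (moeb g (I • (1 : Matrix (Fin 2) (Fin 2) ℂ)))ᴴ))) * a) 0 0).re)) : ℝ)) : ℂ)) = ((((1 / ((((aᴴ * ((2 : ℂ) • ((2 * I)⁻¹ • (moeb g (I • (1 : Matrix (Fin 2) (Fin 2) ℂ)) - (moeb g (I • (1 : Matrix (Fin 2) (Fin 2) ℂ)))ᴴ))) * a) 1 1).re) - normSq ((aᴴ * ((2 : ℂ) • ((2 * I)⁻¹ • (moeb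 g (I • (1 : Matrix (Fin 2) (Fin 2) ℂ)) - (moeb g (I • (1 : Matrix (Fin 2) (Fin 2) ℂ)))ᴴ))) * a) 0 1) / (((aᴴ * ((2 : ℂ) • ((2 * I)⁻¹ • (moeb g (I • (1 : Matrix (Fin 2) (Fin 2) ℂ)) - (moeb g (I • (1 : Matrix (Fin 2) (Fin 2) ℂ)))ᴴ))) * a) 0 0).re))) : ℝ)) : ℂ) by rw [Complex.ofReal_div, Complex.ofReal_one]]
      exact alg_cpow' _ _ _ hx0
  -- (8) the witness at the moving weight parameter
  have hsβ : 1 - (N : ℝ) < ((1 - (k : ℂ) / 2) + s).re := by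
    simp only [add_re, sub_re, one_re, div_ofNat_re, intCast_re] at hs ⊢; linarith
  have hX8 : HasDerivAt (fun τ : ℝ => Φ (1 + k / 2) (1 - k / 2) (((aᴴ * ((2 : ℂ) • ((2 * I)⁻¹ • (moeb (g * NormedSpace.exp (τ • X)) (I • (1 : Matrix (Fin 2) (Fin 2) ℂ)) - (moeb (g * NormedSpace.exp (τ • X)) (I • (1 : Matrix (Fin 2) (Fin 2) ℂ)))ᴴ))) * a) 0 0).re) s) (((P' : ℝ) : ℂ) * (-((1 - (k : ℂ) / 2) + s - 1) * Φ (1 + k / 2) (1 - k / 2 + 1) (((aᴴ * ((2 : ℂ) • ((2 * I)⁻¹ • (moeb g (I • (1 : Matrix (Fin 2) (Fin 2) ℂ)) - (moeb g (I • (1 : Matrix (Fin 2) (Fin 2) ℂ)))ᴴ))) * a) 0 0).re) s)) 0 := by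
    have h := hasDerivAt_comp_weightParam Φ hΦd (1 + k / 2) (1 - k / 2) hpd (by simpa only [e0] using hp0) hsβ
    simp only [e0] at h
    exact h
  -- the product rule in ★ FILE 2b's nesting, then the factorisation by `ring`
  have key := ((hX1.fun_mul hX2).fun_mul hX3).fun_mul ((((hR1.fun_mul (hX6.mul_const (Complex.Gamma (2 * s)))).const_mul (((((4 * Real.pi ^ 4 : ℝ)) : ℂ) * cexp ((Real.pi * I) * ((s + 1 - k / 2) - (s + 1 + k / 2))) * ((Real.pi : ℂ)⁻¹ * (Complex.Gamma (s + 1 + k / 2))⁻¹ * (Complex.Gamma (s + 1 + k / 2 - 1))⁻¹) * ((Real.pi : ℂ)⁻¹ * (Complex.Gamma (s + 1 - k / 2))⁻¹)))).fun_mul hX8).const_mul (1 / 8 : ℂ))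
  simp only [e0] at key
  refine (key.congr_of_eventuallyEq (Filter.Eventually.of_forall fun τ => ?_)).congr_deriv ?_
  · beta_reduce
    rfl
  · ring

end Summit.HodgeConjecture.HodgeConjecture.Cruxes.HLiu418.K2LiuArchTwistedRayFactorDerivs

end
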